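import Mathlib
import HarnessLib

/-!
# The weighted Hardy inequality on a finite interval with both edge terms:
# `½∫ ζ Φ²/r² + ∫ (−ζ') Φ²/r + ζ(r₂)Φ(r₂)²/r₂ ≤ ζ(r₁)Φ(r₁)²/r₁ + 2∫ ζ (Φ')²`

(namespace `Literature.Analysis.Calculus`; companion of `HardyHalfLine.lean`, `HardyExterior.lean`)

Dafermos–Rodnianski–Shlapentokh-Rothman (arXiv:1402.7034, §4.3) and Moschidis (arXiv:1509.08489,
proof of Lemma 4.5: the inequalities (HardyHyperboloid), (HardyPlate)) use one-dimensional Hardy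
inequalities along the generators of hypersurfaces *cut off at a finite radius*, keeping track of
the **edge terms**: along a hyperboloid truncated at `{t = T*}` the edge term at the truncation has
the favourable sign and is kept on the left; on the plate `{t = T*}` between two leaves both edges
appear, the inner one unfavourably. This file proves the underlying real-variable statement, for a
`C¹` function `Φ` on `[r₁, r₂]`, `0 < r₁ ≤ r₂`, and any `C¹` weight `ζ ≥ 0` there (no sign condition
on `ζ'`: where `ζ' ≤ 0`, e.g. a smeared cut-off decreasing outwards, the second term is a favourable
edge-layer term; where `ζ' > 0` it is an error term written on the left):

* `hardy_sq_interval_weighted_le` —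
  `½ ∫_{r₁}^{r₂} ζ Φ²/r² dr + ∫_{r₁}^{r₂} (−ζ') Φ²/r dr + ζ(r₂) Φ(r₂)²/r₂
     ≤ ζ(r₁) Φ(r₁)²/r₁ + 2 ∫_{r₁}^{r₂} ζ (Φ')² dr`
  (from `(ζΦ²/r)' = ζ'Φ²/r + 2ζΦΦ'/r − ζΦ²/r²` and `2ΦΦ'/r ≤ ½Φ²/r² + 2Φ'²`);
* `hardy_sq_interval_le` — the case `ζ ≡ 1`:
  `½ ∫ Φ²/r² + Φ(r₂)²/r₂ ≤ Φ(r₁)²/r₁ + 2 ∫ (Φ')²`.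

With `Φ = r u` (so `Φ²/r² = u²`, `Φ²/r = r u²`, `Φ' = ∂_r(ru)`) and `dy = r² dr dω` these are the
statements used on rays of `ℝ³`. Mathlib has no Hardy inequality. No definitions, no named facts.

## References

* M. Dafermos, I. Rodnianski, Y. Shlapentokh-Rothman, arXiv:1402.7034 = Ann. of Math. 183 (2016),
  §4.3 (key `DafermosRodnianskiShlapentokhrothman2014`).
* G. Moschidis, arXiv:1509.08489 = Ann. PDE 2 (2016), proof of Lemma 4.5 ((HardyHyperboloid),
  (HardyPlate)) (key `Moschidis2016`).
-/

noncomputable section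

open MeasureTheory Set intervalIntegral

namespace Literature.Analysis.Calculus

/-- **Weighted Hardy inequality on `[r₁, r₂]` with both edge terms.** For `0 < r₁ ≤ r₂`, `Φ` and
`ζ` differentiable on `[r₁, r₂]` with continuous derivatives `Φ'`, `ζ'`, and `ζ ≥ 0` on `[r₁, r₂]`
(no sign condition on `ζ'`):
`½ ∫_{r₁}^{r₂} ζ Φ²/r² + ∫_{r₁}^{r₂} (−ζ') Φ²/r + ζ(r₂)Φ(r₂)²/r₂ ≤ ζ(r₁)Φ(r₁)²/r₁ + 2 ∫_{r₁}^{r₂} ζ Φ'²`.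
DRSR arXiv:1402.7034, §4.3; Moschidis arXiv:1509.08489, (HardyHyperboloid). [cite: Moschidis2016, Lemma 4.5 (proof, HardyHyperboloid)] -/
theorem hardy_sq_interval_weighted_le {Φ Φ' ζ ζ' : ℝ → ℝ} {r₁ r₂ : ℝ} (hr₁ : 0 < r₁)
    (hr : r₁ ≤ r₂) (hΦ : ∀ r ∈ Icc r₁ r₂, HasDerivAt Φ (Φ' r) r)
    (hζ : ∀ r ∈ Icc r₁ r₂, HasDerivAt ζ (ζ' r) r) (hΦ'c : ContinuousOn Φ' (Icc r₁ r₂))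
    (hζ'c : ContinuousOn ζ' (Icc r₁ r₂)) (hζ0 : ∀ r ∈ Icc r₁ r₂, 0 ≤ ζ r) :
    (1 / 2) * (∫ r in r₁..r₂, ζ r * Φ r ^ 2 / r ^ 2) + (∫ r in r₁..r₂, (-ζ' r) * Φ r ^ 2 / r) +
        ζ r₂ * Φ r₂ ^ 2 / r₂ ≤
      ζ r₁ * Φ r₁ ^ 2 / r₁ + 2 * ∫ r in r₁..r₂, ζ r * Φ' r ^ 2 := by
  have hpos : ∀ r ∈ Icc r₁ r₂, 0 < r := fun r hr' ↦ hr₁.trans_le hr'.1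
  have hΦc : ContinuousOn Φ (Icc r₁ r₂) := fun r hr' ↦ (hΦ r hr').continuousAt.continuousWithinAt
  have hζc : ContinuousOn ζ (Icc r₁ r₂) := fun r hr' ↦ (hζ r hr').continuousAt.continuousWithinAt
  have hinv : ContinuousOn (fun r : ℝ ↦ r⁻¹) (Icc r₁ r₂) :=
    continuousOn_inv₀.mono fun r hr' ↦ (hpos r hr').ne'
  -- the derivative of `F = ζ Φ² / r`
  have hF : ∀ r ∈ Icc r₁ r₂, HasDerivAt (fun r ↦ ζ r * Φ r ^ 2 / r)
      (ζ' r * Φ r ^ 2 / r + 2 * ζ r * Φ r * Φ' r / r - ζ r * Φ r ^ 2 / r ^ 2) r := by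
    intro r hr'
    have hr0 : r ≠ 0 := (hpos r hr').ne'
    have hΦr : HasDerivAt Φ (Φ' r) r := hΦ r hr'
    have hζr : HasDerivAt ζ (ζ' r) r := hζ r hr'
    have h1 : HasDerivAt (fun r ↦ ζ r * (Φ r * Φ r) / r)
        (((ζ' r * (Φ r * Φ r) + ζ r * (Φ' r * Φ r + Φ r * Φ' r)) * r - ζ r * (Φ r * Φ r) * 1) / r ^ 2)
          r :=
      HasDerivAt.div (HasDerivAt.mul hζr (HasDerivAt.mul hΦr hΦr)) (hasDerivAt_id r) hr0
    have heq : (fun r ↦ ζ r * (Φ r * Φ r) / r) = fun r ↦ ζ r * Φ r ^ 2 / r := by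
      funext r; ring
    rw [heq] at h1
    refine h1.congr_deriv ?_
    field_simp
    ring
  -- integrability of the pieces (continuous on the interval)
  have hIcc : ∀ {f : ℝ → ℝ}, ContinuousOn f (Icc r₁ r₂) → IntervalIntegrable f volume r₁ r₂ :=
    fun hf ↦ (hf.mono (by rw [uIcc_of_le hr])).intervalIntegrable
  have hne : ∀ r ∈ Icc r₁ r₂, (r : ℝ) ≠ 0 := fun r hr' ↦ (hpos r hr').ne'
  have hne2 : ∀ r ∈ Icc r₁ r₂, (r : ℝ) ^ 2 ≠ 0 := fun r hr' ↦ pow_ne_zero 2 (hne r hr')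
  have hcA : ContinuousOn (fun r ↦ ζ r * Φ r ^ 2 / r ^ 2) (Icc r₁ r₂) :=
    (hζc.mul (hΦc.pow 2)).div (continuousOn_id.pow 2) hne2
  have hcB : ContinuousOn (fun r ↦ (-ζ' r) * Φ r ^ 2 / r) (Icc r₁ r₂) :=
    (hζ'c.neg.mul (hΦc.pow 2)).div continuousOn_id hne
  have hcC : ContinuousOn (fun r ↦ ζ r * Φ' r ^ 2) (Icc r₁ r₂) := hζc.mul (hΦ'c.pow 2)
  have hcM : ContinuousOn (fun r ↦ 2 * ζ r * Φ r * Φ' r / r) (Icc r₁ r₂) :=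
    (((continuousOn_const.mul hζc).mul hΦc).mul hΦ'c).div continuousOn_id hne
  have hcF' : ContinuousOn (fun r ↦ ζ' r * Φ r ^ 2 / r + 2 * ζ r * Φ r * Φ' r / r -
      ζ r * Φ r ^ 2 / r ^ 2) (Icc r₁ r₂) := by
    have h1 : ContinuousOn (fun r ↦ ζ' r * Φ r ^ 2 / r) (Icc r₁ r₂) :=
      (hζ'c.mul (hΦc.pow 2)).div continuousOn_id hne
    exact (h1.add hcM).sub hcA
  -- fundamental theorem of calculus
  have hFTC := integral_eq_sub_of_hasDerivAt (fun r hr' ↦ hF r (by rwa [uIcc_of_le hr] at hr'))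
    (hIcc hcF')
  -- pointwise AM–GM for the middle term
  have hmid : (∫ r in r₁..r₂, 2 * ζ r * Φ r * Φ' r / r) ≤
      ∫ r in r₁..r₂, ((1 / 2) * (ζ r * Φ r ^ 2 / r ^ 2) + 2 * (ζ r * Φ' r ^ 2)) := by
    refine integral_mono_on hr (hIcc hcM) ((hIcc hcA).const_mul _ |>.add ((hIcc hcC).const_mul _))
      fun r hr' ↦ ?_
    have hr0 : 0 < r := hpos r hr'
    have hz := hζ0 r hr'
    have key : 2 * Φ r * Φ' r / r ≤ (1 / 2) * (Φ r ^ 2 / r ^ 2) + 2 * Φ' r ^ 2 := by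
      have h := sq_nonneg (Φ r / r - 2 * Φ' r)
      have : 2 * Φ r * Φ' r / r = (Φ r / r) * (2 * Φ' r) := by field_simp
      rw [this]
      have h2 : Φ r ^ 2 / r ^ 2 = (Φ r / r) ^ 2 := by rw [div_pow]
      rw [h2]
      nlinarith [h]
    calc 2 * ζ r * Φ r * Φ' r / r = ζ r * (2 * Φ r * Φ' r / r) := by ring
      _ ≤ ζ r * ((1 / 2) * (Φ r ^ 2 / r ^ 2) + 2 * Φ' r ^ 2) := mul_le_mul_of_nonneg_left key hz
      _ = (1 / 2) * (ζ r * Φ r ^ 2 / r ^ 2) + 2 * (ζ r * Φ' r ^ 2) := by ring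
  -- split the integral of `F'`
  have hsplit : (∫ r in r₁..r₂, (ζ' r * Φ r ^ 2 / r + 2 * ζ r * Φ r * Φ' r / r - ζ r * Φ r ^ 2 / r ^ 2)) =
      -(∫ r in r₁..r₂, (-ζ' r) * Φ r ^ 2 / r) + (∫ r in r₁..r₂, 2 * ζ r * Φ r * Φ' r / r) -
        (∫ r in r₁..r₂, ζ r * Φ r ^ 2 / r ^ 2) := by
    have h1 : IntervalIntegrable (fun r ↦ ζ' r * Φ r ^ 2 / r) volume r₁ r₂ := by
      have := (hIcc hcB).neg
      refine this.congr fun r _ ↦ ?_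
      simp only [Pi.neg_apply]; ring
    rw [integral_sub (h1.add (hIcc hcM)) (hIcc hcA), integral_add h1 (hIcc hcM)]
    have : (∫ r in r₁..r₂, ζ' r * Φ r ^ 2 / r) = -∫ r in r₁..r₂, (-ζ' r) * Φ r ^ 2 / r := by
      rw [← intervalIntegral.integral_neg]
      refine integral_congr fun r _ ↦ ?_
      ring
    rw [this]
  have hAM : (∫ r in r₁..r₂, ((1 / 2) * (ζ r * Φ r ^ 2 / r ^ 2) + 2 * (ζ r * Φ' r ^ 2))) =
      (1 / 2) * (∫ r in r₁..r₂, ζ r * Φ r ^ 2 / r ^ 2) + 2 * ∫ r in r₁..r₂, ζ r * Φ' r ^ 2 := by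
    rw [integral_add ((hIcc hcA).const_mul _) ((hIcc hcC).const_mul _),
      intervalIntegral.integral_const_mul, intervalIntegral.integral_const_mul]
  rw [hsplit] at hFTC
  rw [hAM] at hmid
  -- `F(r₂) − F(r₁) = −B + M − A`, `M ≤ ½A + 2C`
  have hFTC' : ζ r₂ * Φ r₂ ^ 2 / r₂ - ζ r₁ * Φ r₁ ^ 2 / r₁ =
      -(∫ r in r₁..r₂, (-ζ' r) * Φ r ^ 2 / r) + (∫ r in r₁..r₂, 2 * ζ r * Φ r * Φ' r / r) -
        (∫ r in r₁..r₂, ζ r * Φ r ^ 2 / r ^ 2) := by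
    rw [← hFTC]
  linarith [hFTC', hmid]

/-- **Hardy inequality on `[r₁, r₂]` with both edge terms** (`ζ ≡ 1` in
`hardy_sq_interval_weighted_le`): for `0 < r₁ ≤ r₂` and `Φ` continuously differentiable near
`[r₁, r₂]`, `½ ∫_{r₁}^{r₂} Φ²/r² + Φ(r₂)²/r₂ ≤ Φ(r₁)²/r₁ + 2 ∫_{r₁}^{r₂} Φ'²` — the outer edge with the
favourable sign, the inner edge on the right (Moschidis arXiv:1509.08489, (HardyPlate)).
[cite: Moschidis2016, Lemma 4.5 (proof, HardyPlate)] -/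
theorem hardy_sq_interval_le {Φ Φ' : ℝ → ℝ} {r₁ r₂ : ℝ} (hr₁ : 0 < r₁) (hr : r₁ ≤ r₂)
    (hΦ : ∀ r ∈ Icc r₁ r₂, HasDerivAt Φ (Φ' r) r) (hΦ'c : ContinuousOn Φ' (Icc r₁ r₂)) :
    (1 / 2) * (∫ r in r₁..r₂, Φ r ^ 2 / r ^ 2) + Φ r₂ ^ 2 / r₂ ≤
      Φ r₁ ^ 2 / r₁ + 2 * ∫ r in r₁..r₂, Φ' r ^ 2 := by
  have h := hardy_sq_interval_weighted_le (ζ := fun _ ↦ 1) (ζ' := fun _ ↦ 0) hr₁ hr hΦ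
    (fun r _ ↦ hasDerivAt_const r 1) hΦ'c continuousOn_const (fun _ _ ↦ zero_le_one)
  simp only [one_mul, neg_zero, zero_mul, zero_div, intervalIntegral.integral_zero, add_zero] at h
  exact h

end Literature.Analysis.Calculus
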